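import Summits.Ventures.HodgeRepro2.T5SU11JacobiWendelBounds
import Summits.Ventures.HodgeRepro2.T5SU11JacobiWeight

/-!
# The two-step recursion in the PARAMETER: `m̂_k(λ + 2) = ((k + λ − 2)/(k − λ − 2)) m̂_k(λ)`;
the Wendel envelope beyond `0 ≤ λ ≤ 2`

The symmetric closed form `m̂_k(λ) = π Γ((k−λ)/2) Γ((k+λ)/2 − 1)/Γ(k/2)²` (`T5SU11JacobiDuplication`) and
`Γ(s + 1) = s Γ(s)` give, next to the recursion in the weight (`T5SU11JacobiWeightRecursion`), a
**two-step recursion in the spectral parameter**: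

  **`m̂_k(λ + 2) = ((k + λ − 2)/(k − λ − 2)) · m̂_k(λ)`**   (`jacobi_param_add_two`)

on `k > max(1, λ + 2, −λ)` — the shift `λ ↦ λ + 2` is a rational factor, the reflection of the Gamma
functional equation in the two factors `Γ((k∓λ)/2 ∓ …)`. Consequences: the explicit two-sided Wendel
envelope of `T5SU11JacobiWendelBounds` (valid on the unitary range `0 ≤ λ ≤ 2`) transports to
`2 ≤ λ ≤ 4` (`jacobi_ge_wendel_shift`, `jacobi_le_wendel_shift`: the envelope at `λ − 2` times the factor
`(k + λ − 4)/(k − λ)`), and by the `W`-symmetry `λ ↦ 2 − λ` to `−2 ≤ λ ≤ 0` (`jacobi_ge_wendel_neg`,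
`jacobi_le_wendel_neg`) — candidate (xvi) of the support record. The iterated form
`m̂_k(λ + 2n) = m̂_k(λ) ∏_{i<n} (k + λ + 2i − 2)/(k − λ − 2i − 2)` is `jacobi_param_add_two_mul`. Nothing is
claimed about (N).

Blind lane: Mathlib + the HodgeRepro2 prefix only; no sorry; axioms ⊆ {propext, Classical.choice,
Quot.sound}.
-/

namespace Summit.Ventures.HodgeRepro2.T5SU11JacobiParamRecursion

open MeasureTheory MeasureTheory.Measure Metric Set Filter Topology Finset
open T5SU11Unimodular T5SU11Fibration T5SU11Cartan T5HaarCircle T5BergmanCoefficient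
  T5SU11FibrationHaar T5SU11SphericalFunction T5SU11SphericalSymmetry T5SU11SphericalBounds
  T5SU11SphericalContinuous T5SU11JacobiIwasawa T5SU11JacobiTransform T5SU11JacobiWeight
  T5SU11KFiniteMajorantPow T5SU11JacobiDuplication T5SU11JacobiWendelBounds
open scoped Real

section measure

variable [MeasurableSpace Circle] [BorelSpace Circle]

/-- **THE TWO-STEP RECURSION IN THE PARAMETER**: for `k > 1`, `λ + 2 < k`, `k + λ > 2`,
`m̂_k(λ + 2) = ((k + λ − 2)/(k − λ − 2)) · m̂_k(λ)`. -/
theorem jacobi_param_add_two {k lam : ℝ} (hk : 1 < k) (h1 : lam + 2 < k) (h2 : 2 < k + lam) :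
    ∫ g, (1 - ‖orbit g‖ ^ 2) ^ (k / 2) * sph (lam + 2) g ∂(nu haarCircle)
      = (k + lam - 2) / (k - lam - 2) * ∫ g, (1 - ‖orbit g‖ ^ 2) ^ (k / 2) * sph lam g ∂(nu haarCircle) := by
  rw [integral_orbit_rpow_mul_sph_dup hk h1 (by linarith),
    integral_orbit_rpow_mul_sph_dup hk (by linarith) h2,
    show (k - lam) / 2 = (k - (lam + 2)) / 2 + 1 by ring,
    show (k + (lam + 2)) / 2 - 1 = ((k + lam) / 2 - 1) + 1 by ring,
    Real.Gamma_add_one (by intro h; linarith : (k - (lam + 2)) / 2 ≠ 0),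
    Real.Gamma_add_one (by intro h; linarith : (k + lam) / 2 - 1 ≠ 0)]
  have g : 0 < Real.Gamma (k / 2) := Real.Gamma_pos_of_pos (by linarith)
  have h3 : k - lam - 2 ≠ 0 := by intro h; linarith
  field_simp
  ring

/-- The iterated form: `m̂_k(λ + 2n) = (∏_{i<n} (k + λ + 2i − 2)/(k − λ − 2i − 2)) · m̂_k(λ)` for
`k > 1`, `λ + 2n < k`, `k + λ > 2`. -/
theorem jacobi_param_add_two_mul {k lam : ℝ} (hk : 1 < k) (h2 : 2 < k + lam) (n : ℕ)
    (h1 : lam + 2 * n < k) :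
    ∫ g, (1 - ‖orbit g‖ ^ 2) ^ (k / 2) * sph (lam + 2 * n) g ∂(nu haarCircle)
      = (∏ i ∈ range n, (k + (lam + 2 * i) - 2) / (k - (lam + 2 * i) - 2))
        * ∫ g, (1 - ‖orbit g‖ ^ 2) ^ (k / 2) * sph lam g ∂(nu haarCircle) := by
  induction n with
  | zero => simp
  | succ n ih =>
    have hc : (2 : ℝ) * ((n + 1 : ℕ) : ℝ) = 2 * n + 2 := by push_cast; ring
    rw [hc] at h1
    have hn : (0 : ℝ) ≤ 2 * n := by positivity
    rw [show lam + 2 * ((n + 1 : ℕ) : ℝ) = (lam + 2 * n) + 2 by rw [hc]; ring,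
      jacobi_param_add_two hk (by linarith) (by linarith), ih (by linarith), Finset.prod_range_succ]
    ring

/-! ### The Wendel envelope transported to `2 ≤ λ ≤ 4` and to `−2 ≤ λ ≤ 0` -/

/-- The lower Wendel bound on `2 ≤ λ ≤ 4`, `k > λ`: `m̂_k(λ) ≥ ((k + λ − 4)/(k − λ)) · L_k(λ − 2)` with
`L_k(μ) = π (k/2 − μ/2)^{−μ/2} (k/2 − (1 − μ/2))^{−(1 − μ/2)}` the lower envelope of
`T5SU11JacobiWendelBounds`. -/
theorem jacobi_ge_wendel_shift {k lam : ℝ} (hk : lam < k) (h0 : 2 ≤ lam) (h2 : lam ≤ 4) :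
    (k + lam - 4) / (k - lam)
        * (π * (k / 2 - (lam - 2) / 2) ^ (-((lam - 2) / 2))
          * (k / 2 - (1 - (lam - 2) / 2)) ^ (-(1 - (lam - 2) / 2)))
      ≤ ∫ g, (1 - ‖orbit g‖ ^ 2) ^ (k / 2) * sph lam g ∂(nu haarCircle) := by
  have hk2 : 2 < k := by linarith
  have e := jacobi_param_add_two (lam := lam - 2) (by linarith) (by linarith) (by linarith)
  rw [sub_add_cancel] at e
  rw [e, show k + (lam - 2) - 2 = k + lam - 4 by ring, show k - (lam - 2) - 2 = k - lam by ring]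
  exact mul_le_mul_of_nonneg_left (jacobi_ge_wendel hk2 (by linarith) (by linarith))
    (div_nonneg (by linarith) (by linarith))

/-- The upper Wendel bound on `2 ≤ λ ≤ 4`, `k > λ`: `m̂_k(λ) ≤ ((k + λ − 4)/(k − λ)) · U_k(λ − 2)` with
`U_k(μ) = π (k/2)/((k/2 − μ/2)(k/2 − (1 − μ/2)))` the upper envelope of `T5SU11JacobiWendelBounds`. -/
theorem jacobi_le_wendel_shift {k lam : ℝ} (hk : lam < k) (h0 : 2 ≤ lam) (h2 : lam ≤ 4) :
    ∫ g, (1 - ‖orbit g‖ ^ 2) ^ (k / 2) * sph lam g ∂(nu haarCircle)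
      ≤ (k + lam - 4) / (k - lam)
        * (π * (k / 2) / ((k / 2 - (lam - 2) / 2) * (k / 2 - (1 - (lam - 2) / 2)))) := by
  have hk2 : 2 < k := by linarith
  have e := jacobi_param_add_two (lam := lam - 2) (by linarith) (by linarith) (by linarith)
  rw [sub_add_cancel] at e
  rw [e, show k + (lam - 2) - 2 = k + lam - 4 by ring, show k - (lam - 2) - 2 = k - lam by ring]
  exact mul_le_mul_of_nonneg_left (jacobi_le_wendel hk2 (by linarith) (by linarith))
    (div_nonneg (by linarith) (by linarith))

/-- The lower Wendel bound on `−2 ≤ λ ≤ 0`, `k > 2 − λ` (the `W`-symmetry `φ_λ = φ_{2−λ}` and the bound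
on `2 ≤ 2 − λ ≤ 4`). -/
theorem jacobi_ge_wendel_neg {k lam : ℝ} (hk : 2 - lam < k) (h0 : -2 ≤ lam) (h2 : lam ≤ 0) :
    (k + (2 - lam) - 4) / (k - (2 - lam))
        * (π * (k / 2 - (2 - lam - 2) / 2) ^ (-((2 - lam - 2) / 2))
          * (k / 2 - (1 - (2 - lam - 2) / 2)) ^ (-(1 - (2 - lam - 2) / 2)))
      ≤ ∫ g, (1 - ‖orbit g‖ ^ 2) ^ (k / 2) * sph lam g ∂(nu haarCircle) := by
  have e : ∀ g : SU11, sph lam g = sph (2 - lam) g := fun g => sph_two_sub lam g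
  simp_rw [e]
  exact jacobi_ge_wendel_shift hk (by linarith) (by linarith)

/-- The upper Wendel bound on `−2 ≤ λ ≤ 0`, `k > 2 − λ`. -/
theorem jacobi_le_wendel_neg {k lam : ℝ} (hk : 2 - lam < k) (h0 : -2 ≤ lam) (h2 : lam ≤ 0) :
    ∫ g, (1 - ‖orbit g‖ ^ 2) ^ (k / 2) * sph lam g ∂(nu haarCircle)
      ≤ (k + (2 - lam) - 4) / (k - (2 - lam))
        * (π * (k / 2) / ((k / 2 - (2 - lam - 2) / 2) * (k / 2 - (1 - (2 - lam - 2) / 2)))) := by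
  have e : ∀ g : SU11, sph lam g = sph (2 - lam) g := fun g => sph_two_sub lam g
  simp_rw [e]
  exact jacobi_le_wendel_shift hk (by linarith) (by linarith)

end measure

end Summit.Ventures.HodgeRepro2.T5SU11JacobiParamRecursion
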